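import Mathlib
import HarnessLib
import HarnessLib.Audit
import Summits.ABC.Statement
import Literature.Barriers.ABC.BakerMethodBoundsStewartTijdemanGenericProofs
import Literature.Barriers.ABC.BakerMethodBoundsEpsShape
import Summits.ABC.ABC.Theorems.PadicPrimesW80TwoThirdsW80ThreeModFour
import Summits.ABC.ABC.Theorems.PadicPrimesW80TwoThirdsW80OneModFour
import HarnessLib.Audit.Status.Attr

/-!
Route: PadicPrimesW80OddRadOne

CLOSED (proved) 2026-08-26T11:53:31Z by planner-abc-stewartyu-plan-g6-0 — reason: proved:Summit.ABC.ABC.Theorems.epsShapeBoundOne_holds — note: rung F-A1.M2⁻ EpsShapeBoundOne proved in tree: epsShapeBoundOne_holds p440439 commit 251b98db6751 (axioms whitelist); all 5 in-cone items closed·proved (19443, 19485 p437712, 19487 p439717, 19536, 19537). The file is kept as the record of this route; refuted decls are indexed as negative knowledge (`ledger negatives`).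

# Route PadicPrimesW80OddRadOne — log c ≪_ε rad^(1+ε) from the Waldschmidt-binder p-adic texts at
the ODD primes only (cruxes shared with route PadicPrimesW80TwoThirds), through the odd κ-door with
κ = 1

RUNG ROUTE A1.M2⁻ (D-0059/D-0061, class rung, never summit credit; v3 2026-08-26T07:0xZ): it
suffices to show the two ODD-class
Waldschmidt-binder texts W80ThreeModFour and W80OneModFour — ord_p(∏q^(e_q) − 1) < (c₅
#S)^#S·p²·(log B + log log A)·log log A·
∏ log max(4,q) for p ≡ 3 resp. 1 (mod 4), the SAME items as route PadicPrimesW80TwoThirds (rung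
A1.M2) and verbatim the outputs of
the tree transfers `threeModFour_of_w80Engine` / `oneModFour_of_w80Engine` from the unit-form
engines (p2 memo-04 PATH Z) — because
(support FinFromW80Odd = p3's `YuNinetyW80Kappa.finBoundAt_of_residueClass_aux`, p428600) they give
the κ-door input FinBoundAt p K L 1 2 1 2
at every odd prime, and the landed odd κ-door (support OddKappaDoorSpec, free powers of log B and
log ∏q) turns that into
EpsShapeBound (max 1 1) = EpsShapeBoundOne, i.e. log c ≪_ε rad(abc)^(1+ε). No 2-adic engine, no new
door. (Successor of route PadicPrimesYuNinetyOddRadOne, whose Fin-form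
cruxes stmt-ABC-19455/19456 were mooted by a gate side-effect; this route shares the engine-facing
items instead of duplicating them.)
Lean: `∃ c₅ : ℝ, ∀ (p : ℕ), p.Prime → p % 4 = 3 → ∀ (S : Finset ℕ), (∀ q ∈ S, q.Prime) → p ∉ S →
S.Nonempty → ∀ (e : ℕ → ℤ) (B : ℝ), 3 ≤ B → (∀ q ∈ S, (|e q| : ℝ) ≤ B) → ∏ q ∈ S, (q : ℚ) ^ e q ≠ 1
→ (padicValRat p (∏ q ∈ S, (q : ℚ) ^ e q - 1) : ℝ) < (c₅ * S.card) ^ S.card * (p : ℝ) ^ 2 *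
((Real.log B + Real.log (Real.log ((max 4 (S.sup id) : ℕ) : ℝ))) * Real.log (Real.log ((max 4 (S.sup
id) : ℕ) : ℝ))) * ∏ q ∈ S, Real.log ((max 4 q : ℕ) : ℝ)`

## Assembly
Pure logic (`glueM2minus3.lean`; farm rc 0 / 0 sorries in the planner's w80/SketchM2minus3.lean): K,
L from FinFromW80Odd applied to the
two cruxes; OddKappaDoorSpec at (κ, σ, τ, τ₁) = (1, 2, 1, 2); `max 1 1 = 1` by simp;
`epsShapeBoundOne_iff`.

CLOSES_TARGET: closes rung F-A1.M2⁻ of ABC: Literature.Barriers.ABC.EpsShapeBoundOne (D-0061; not the summit Statement) — the deciding theorem of this route concludes that registered leaf instead of the Statement decl `ABC` (class rung: servable and labelled, never counted as concluding the summit Statement).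

Rationale: WHY THIS LINE. Mechanism: Stewart–Yu 1991 §3 at the odd places (max-ord device, Lemma 4,
Waldschmidt's archimedean route when a < √b), generalised
by the cell to inputs K·Lⁿ·n^(κn)·p^σ·(log B)^τ·(log Π)^τ₁ with free τ, τ₁ [StewartYu1991 §3
(17)–(18), StewartTijdeman1986] —
the extra log Π of the W80 binder is absorbed in rad^ε. The p-adic input is Yu 1990's twisted
auxiliary function [Yu1990 §2:
Teichmüller twist, classes mod (p−1)/2] driven by the LANDED Cijsouw–Waldschmidt machine
[Waldschmidt1980; tree PadicCW77*/
PadicW80Par] in log-p units, whose output binder is (W + m log(mV))·m log(mV) (p2 memo-04 §1: plain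
z-derivatives τ₀! ≤ T^T and
plain powers force W⋆ = max(W, m log(mV)); Baker-Δ weights would remove it at +3–4 kLoC). Imported:
nothing outside the Baker class;
the route is the ledger record of the intermediate rung so that the odd engine is credited as
rad^(1+ε) the hour it closes.

RANKED CRUXES. #2 W80ThreeModFour (crux) — there is c₅ such that for every prime p with p ≡ 3 (mod
4), every finite set S of primes q ≠ p (S ≠ ∅), exponents |e_q| ≤ B (B ≥ 3) with ∏q^(e_q) ≠ 1:
ord_p(∏_{q∈S} q^(e_q) − 1) < (c₅·#S)^#S · p² · (log B + log log A)·log log A · ∏_{q∈S} log max(4,q),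
A = max(4, max S); SHARED with route PadicPrimesW80TwoThirds; verbatim the conclusion of the tree's
`residueClass_of_w80Engine` instance. Line (lead p2-g2, PATH Z): twisted W80 architecture in log-p
units ⇒ unit-form engine ⇒ this text by `threeModFour_of_w80Engine`. [difficulty: XL] (why it might
fail: Engine Z is unbuilt (≈ 6.5 kLoC): the class price (p−1)/2, the W-floor log p and one log log p
must fit p² ((log p)² ≤ 4p pays), and the (log p)-unit W80 numerics (S5) must close for every m; a
failure restates the binder.) [Yu1990, Waldschmidt1980, StewartYu1991]
#3 W80OneModFour (crux) — there is c₅ such that for every prime p with p ≡ 1 (mod 4), every finite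
set S of primes q ≠ p (S ≠ ∅), exponents |e_q| ≤ B (B ≥ 3) with ∏q^(e_q) ≠ 1: ord_p(∏_{q∈S} q^(e_q)
− 1) < (c₅·#S)^#S · p² · (log B + log log A)·log log A · ∏_{q∈S} log max(4,q), A = max(4, max S);
SHARED with route PadicPrimesW80TwoThirds; verbatim the conclusion of the tree's
`residueClass_of_w80Engine` instance. Line: the same engine with p3-g2's parity-bit half-step in
ℂ_[p] ⇒ text by `oneModFour_of_w80Engine`. [difficulty: L] (why it might fail: Same engine plus the
half-step OUTSIDE ℚ_p (ξ² = ζ has no root in ℚ_p at p ≡ 1 mod 4): fails if the PadicComplex norm API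
cannot carry the half-step sizes inside the landed Main's HalfStep interface, or the class-bit
doubles T beyond the numerics.) [Yu1990, Waldschmidt1980]
#9 FinFromW80Odd (support) — The two odd-class Waldschmidt-binder texts give the κ-door input at
every odd prime: ∃ K ≥ 0, L ≥ 1 with ord_p(∏qᵢ^eᵢ − 1) ≤ K·Lⁿ·nⁿ·p²·∏ log qᵢ·log max(3,max|eᵢ|)·(log
max(3,∏qᵢ))² for all odd p (Finset ↔ Fin bookkeeping, log max(4,q) ≤ 2 log q, (log B + log log
A)·log log A ≤ 3·log B·(log max(3,∏q))²) — p3's `YuNinetyW80Kappa.finBoundAt_of_residueClass_aux`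
(p428600; K = 8, L = 2·max(1,|c₅|,|c₅'|)). [difficulty: provable-now] [StewartYu1991]
#9 OddKappaDoorSpec (support) — The κ-door at the odd places (text of the CLOSED item stmt-ABC-19895
of route PadicPrincipalCoreRadThree; tree
`Summit.ABC.StewartYu.KappaDoor.epsShapeBound_of_oddFinBound`): a one-prime bound with σ ≤ 2 at
every ODD prime (any K ≥ 0, L ≥ 1, κ ≥ 0, τ, τ₁) gives EpsShapeBound (max 1 κ). [difficulty:
provable-now] [StewartYu1991, StewartTijdeman1986]

TWO-LAYER PLAN. The two cruxes are SHARED with route PadicPrimesW80TwoThirds (rung A1.M2); their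
skeleton lines (engine stub in unit form +
Fin transfer) are registered by the lead p2-g2; the two supports are one closer each (merge: planner
Sketch; door: stmt-ABC-19895's proof).

KILL CRITERIA. A log log p surviving in the engine's output (σ = 2 has no spare power of p) restates
both cruxes to '∀ δ > 0 … σ = 2 + δ' and
needs a σ-graded door; a refutation of either crux as typed by a numerics counterexample at small
(n, p) restates the binder.
Nothing else kills a rung record; the Yu-shaped route PadicPrimesYuNinety stays as fallback.

NOT DECOMPOSED YET. The engine itself (twins of the landed layers, class Siegel, half-step providers
A/B, TwistW80Par numerics) — stubs of the
lead's skeleton, not items; see route PadicPrimesKappaDoorTwoThirds for the p = 2 class and the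
three-slot door.

CHEAPEST FALSIFIER. n = 1 (one prime q, exponent e): ord_p(q^e − 1) ≤ K·L·p²·log q·log
max(3,|e|)·(log max(3,q))² from the tree's one-logarithm
lemma (Dioph.padicValRat_zpow_sub_one_mul_log_le') — the BC5 rung `finBoundThreeModFour_card_le_one`
(WANTED, any prover);
and the glue arithmetic (done: SketchW80.lean rc 0).

NUMBERS. κ = 1, σ = 2, τ = 1, τ₁ = 2; exponent 1 + ε versus 5/2 (in tree), 2 (staged B₂), 5/3
(three-slot door + 2-adic engine), 2/3 (M2).
ETA (D-0071): FinBoundThreeModFour 2026-08-29/30 (p2-g2 Z ≈ 6.5 kLoC), FinBoundOneModFour 2026-08-31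
(p3-g2 delta ≈ 1 kLoC).

Novelty: Searches run: `lean search 'EpsShapeBound 1'` / `--decl EpsShapeBoundOne` (leaf :99, listed rung
F-A1.M2⁻), `ledger negatives --problem ABC`
(no statement of this shape), `lit search --hybrid "Stewart Yu 1991 odd primes only exponent abc"`,
`lit search --hybrid "Waldschmidt 1980
p-adic lower bound linear forms log B log log A"`. Nearest prior art found: StewartYu1991 itself
(all places, 2/3); Waldschmidt1980 /
van der Poorten 1977 shapes; the cell's OddKappaDoorSpec (stmt-ABC-19895). Delta: records that a
W80-binder bound for rational
primes at the odd places alone already yields rad^(1+ε) through the landed door — a re-threading,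
grade expected known/variant (rung record).  [refs: StewartYu1991, Waldschmidt1980]

Barriers (technique_class: baker-linear-forms, kummer-theory): - technique_class: baker-linear-forms, kummer-theory
- Literature.Barriers.ABC.BakerMethodBounds (Baker-class bounds are exponential in rad): it does not
evade it; the bet is a RUNG inside the class (log c ≪ rad^(1+ε)), class rung, never summit credit.

History (route lifecycle, newest last):
- 2026-08-26T11:53:31Z · CLOSED proved — proved:Summit.ABC.ABC.Theorems.epsShapeBoundOne_holds (planner-abc-stewartyu-plan-g6-0)

sub-problem: ABC · status: closed(proved) · opened planner-abc-stewartyu-plan-g4-0 2026-08-26T07:19:36Z · rev 0 · ledger route-ABC-PadicPrimesW80OddRadOne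
GENERATED by the gate from the ledger (D-0016/17). Provers cite these decls: `theorem foo : Summit.ABC.ABC.Theses.PadicPrimesW80OddRadOne.<Decl> := …` in Summits/ABC/ABC/Theorems/<Name>.lean.
-/

namespace Summit.ABC.ABC.Theses.PadicPrimesW80OddRadOne

open scoped BigOperators Topology Manifold Classical MeasureTheory ProbabilityTheory Matrix InnerProductSpace ComplexConjugate ContinuousMap
open Filter Set Function TopologicalSpace MeasureTheory

attribute [summit_statement] _root_.ABC
attribute [summit_statement] _root_.Literature.Barriers.ABC.EpsShapeBoundOne

open Literature.Abc

/-- item stmt-ABC-19485 · crux · rank 2 · closed · proved by Summit.ABC.ABC.Theorems.padicPrimesW80TwoThirds_w80ThreeModFour_proof (prover) · by planner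
why it might fail: Engine Z is unbuilt (≈ 6.5 kLoC): the class price (p−1)/2, the W-floor log p and one log log p must fit p² ((log p)² ≤ 4p pays), and the (log p)-unit W80 numerics (S5) must close for every m; a failure restates the binder.
sources: Yu1990, Waldschmidt1980, StewartYu1991
[crux] there is c₅ such that for every prime p with p ≡ 3 (mod 4), every finite set S of primes q ≠
p (S ≠ ∅), exponents |e_q| ≤ B (B ≥ 3) with ∏q^(e_q) ≠ 1: ord_p(∏_{q∈S} q^(e_q) − 1) < (c₅·#S)^#S ·
p² · (log B + log log A)·log log A · ∏_{q∈S} log max(4,q), A = max(4, max S) — Yu 1990's quality (c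
n)ⁿ·p² with WALDSCHMIDT 1980's binder (W + log V)·log V; verbatim the conclusion of the tree's
`Summit.ABC.StewartYu.YuNinetyW80.residueClass_of_w80Engine` (p428501) and the binder of the landed
door `Literature.Barriers.ABC.stewartYu1991_of_w80Shape` (p427924). Line (lead p2-g2, PATH Z,
memo-04 §3): the K = ℚ Teichmüller-twist engine on the LANDED CW77/W80 architecture in log-p units
(PadicTwistSetup p428006, PadicTwistValues p428445 landed; Functions/Series/KStep/Main staged;
half-step provider A = QR-normalisation in ℚ_p; TwistW80Par; log-p sizes) ⇒ unit-form engine ⇒ this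
text by `threeModFour_of_w80Engine` (tree). [difficulty: XL] -/
@[route_item "route-ABC-PadicPrimesW80OddRadOne", crux]
def W80ThreeModFour : Prop :=
  ∃ c₅ : ℝ, ∀ (p : ℕ), p.Prime → p % 4 = 3 → ∀ (S : Finset ℕ), (∀ q ∈ S, q.Prime) → p ∉ S → S.Nonempty → ∀ (e : ℕ → ℤ) (B : ℝ), 3 ≤ B → (∀ q ∈ S, (|e q| : ℝ) ≤ B) → ∏ q ∈ S, (q : ℚ) ^ e q ≠ 1 → (padicValRat p (∏ q ∈ S, (q : ℚ) ^ e q - 1) : ℝ) < (c₅ * S.card) ^ S.card * (p : ℝ) ^ 2 * ((Real.log B + Real.log (Real.log ((max 4 (S.sup id) : ℕ) : ℝ))) * Real.log (Real.log ((max 4 (S.sup id) : ℕ) : ℝ))) * ∏ q ∈ S, Real.log ((max 4 q : ℕ) : ℝ)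

/-- `W80ThreeModFour` holds: proved by `Summit.ABC.ABC.Theorems.padicPrimesW80TwoThirds_w80ThreeModFour_proof`. -/
theorem W80ThreeModFour_holds : W80ThreeModFour := _root_.Summit.ABC.ABC.Theorems.padicPrimesW80TwoThirds_w80ThreeModFour_proof

/-- item stmt-ABC-19487 · crux · rank 3 · closed · proved by Summit.ABC.ABC.Cruxes.W80OneModFour.ParityTwistW80.W80OneModFour_of (prover) · by planner
why it might fail: Same engine plus the half-step OUTSIDE ℚ_p (ξ² = ζ has no root in ℚ_p at p ≡ 1 mod 4): fails if the PadicComplex norm API cannot carry the half-step sizes inside the landed Main's HalfStep interface, or the class-bit doubles T beyond the numerics.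
sources: Yu1990, Waldschmidt1980
[crux] there is c₅ such that for every prime p with p ≡ 1 (mod 4), every finite set S of primes q ≠
p (S ≠ ∅), exponents |e_q| ≤ B (B ≥ 3) with ∏q^(e_q) ≠ 1: ord_p(∏_{q∈S} q^(e_q) − 1) < (c₅·#S)^#S ·
p² · (log B + log log A)·log log A · ∏_{q∈S} log max(4,q), A = max(4, max S) — Yu 1990's quality (c
n)ⁿ·p² with WALDSCHMIDT 1980's binder (W + log V)·log V; verbatim the conclusion of the tree's
`Summit.ABC.StewartYu.YuNinetyW80.residueClass_of_w80Engine` (p428501) and the binder of the landed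
door `Literature.Barriers.ABC.stewartYu1991_of_w80Shape` (p427924). Line: the same engine with
p3-g2's parity-bit half-step outside ℚ_p (classes mod (p−1)/2 + one bit; Liouville over ℚ(ι,√α) in
ℂ_[p]: PadicComplexLiouville p425563, TwistHalfPointAlgebra p427086 landed) ⇒ text by
`oneModFour_of_w80Engine` (tree). [difficulty: L] -/
@[route_item "route-ABC-PadicPrimesW80OddRadOne", crux]
def W80OneModFour : Prop :=
  ∃ c₅ : ℝ, ∀ (p : ℕ), p.Prime → p % 4 = 1 → ∀ (S : Finset ℕ), (∀ q ∈ S, q.Prime) → p ∉ S → S.Nonempty → ∀ (e : ℕ → ℤ) (B : ℝ), 3 ≤ B → (∀ q ∈ S, (|e q| : ℝ) ≤ B) → ∏ q ∈ S, (q : ℚ) ^ e q ≠ 1 → (padicValRat p (∏ q ∈ S, (q : ℚ) ^ e q - 1) : ℝ) < (c₅ * S.card) ^ S.card * (p : ℝ) ^ 2 * ((Real.log B + Real.log (Real.log ((max 4 (S.sup id) : ℕ) : ℝ))) * Real.log (Real.log ((max 4 (S.sup id) : ℕ) : ℝ))) * ∏ q ∈ S, Real.log ((max 4 q : ℕ)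 : ℝ)

/-- `W80OneModFour` holds: proved by `Summit.ABC.ABC.Cruxes.W80OneModFour.ParityTwistW80.W80OneModFour_of`. -/
theorem W80OneModFour_holds : W80OneModFour := _root_.Summit.ABC.ABC.Cruxes.W80OneModFour.ParityTwistW80.W80OneModFour_of

/-- item stmt-ABC-19443 · support · rank 9 · closed · proved by Summit.ABC.ABC.Theorems.padicPrimesW80OddRadOne_finFromW80Odd_proof (prover) · by planner
sources: StewartYu1991
[support] the two odd-class Waldschmidt-binder texts (W80ThreeModFour, W80OneModFour of route
PadicPrimesW80TwoThirds) give the κ-door input FinBoundAt p K L 1 2 1 2 at every odd prime — p3's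
YuNinetyW80Kappa.finBoundAt_of_residueClass_aux (p428600; K = 8, L = 2·max(1,|c₅|,|c₅'|)); source
StewartYu1991. -/
@[route_item "route-ABC-PadicPrimesW80OddRadOne", crux]
def FinFromW80Odd : Prop :=
  (∃ c₅ : ℝ, ∀ (p : ℕ), p.Prime → p % 4 = 3 → ∀ (S : Finset ℕ), (∀ q ∈ S, q.Prime) → p ∉ S → S.Nonempty → ∀ (e : ℕ → ℤ) (B : ℝ), 3 ≤ B → (∀ q ∈ S, (|e q| : ℝ) ≤ B) → ∏ q ∈ S, (q : ℚ) ^ e q ≠ 1 → (padicValRat p (∏ q ∈ S, (q : ℚ) ^ e q - 1) : ℝ) < (c₅ * S.card) ^ S.card * (p : ℝ) ^ 2 * ((Real.log B + Real.log (Real.log ((max 4 (S.sup id) : ℕ) : ℝ))) * Real.log (Real.log ((max 4 (S.sup id) : ℕ) : ℝ))) * ∏ q ∈ S, Real.log ((max 4 q : ℕ) : ℝ)) → (∃ c₅ : ℝ, ∀ (p : ℕ), p.Prime → p % 4 = 1 → ∀ (S : Finset ℕ), (∀ q ∈ S, q.Prime) → p ∉ S → S.Nonempty → ∀ (e : ℕ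 → ℤ) (B : ℝ), 3 ≤ B → (∀ q ∈ S, (|e q| : ℝ) ≤ B) → ∏ q ∈ S, (q : ℚ) ^ e q ≠ 1 → (padicValRat p (∏ q ∈ S, (q : ℚ) ^ e q - 1) : ℝ) < (c₅ * S.card) ^ S.card * (p : ℝ) ^ 2 * ((Real.log B + Real.log (Real.log ((max 4 (S.sup id) : ℕ) : ℝ))) * Real.log (Real.log ((max 4 (S.sup id) : ℕ) : ℝ))) * ∏ q ∈ S, Real.log ((max 4 q : ℕ) : ℝ)) → ∃ (K L : ℝ), 0 ≤ K ∧ 1 ≤ L ∧ ∀ p, p.Prime → p ≠ 2 → (∀ (n : ℕ) (q : Fin n → ℕ) (e : Fin n → ℤ), (∀ i, (q i).Prime) → Function.Injective q → (∀ i, q i ≠ p) → e ≠ 0 → ∏ i, ((q i : ℚ)) ^ e i ≠ 1 → (padicValRat p (∏ i, ((q i : ℚ)) ^ e i - 1) : ℝ) ≤ K * L ^ n * (n : ℝ) ^ ((1 : ℝ) * n) * (p : ℝ) ^ (2 : ℝ) * (∏ i, Real.log (q i)) * Real.log (max 3 ((Finset.univ.sup fun i => (e i).natAbs : ℕ) :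 ℝ)) ^ (1 : ℕ) * Real.log (max 3 (∏ i, ((q i : ℕ) : ℝ))) ^ (2 : ℕ))

-- `FinFromW80Odd` holds: proved by `Summit.ABC.ABC.Theorems.padicPrimesW80OddRadOne_finFromW80Odd_proof` (its module imports this route file, so no `_holds` link can be stated here).

/-- item stmt-ABC-19536 · support · rank 9 · closed · proved by Summit.ABC.ABC.Theorems.padicPrimesW80OddRadOne_oddKappaDoorSpec_proof (prover) · by planner
sources: StewartYu1991, StewartTijdeman1986
[support] The κ-door at the odd places (text of the CLOSED item stmt-ABC-19895 of route
PadicPrincipalCoreRadThree; tree `Summit.ABC.StewartYu.KappaDoor.epsShapeBound_of_oddFinBound`): a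
one-prime bound with σ ≤ 2 at every ODD prime (any K ≥ 0, L ≥ 1, κ ≥ 0, τ, τ₁) gives EpsShapeBound
(max 1 κ). [difficulty: provable-now] -/
@[route_item "route-ABC-PadicPrimesW80OddRadOne", crux]
def OddKappaDoorSpec : Prop :=
  ∀ (K L κ σ : ℝ) (τ τ₁ : ℕ), 0 ≤ K → 1 ≤ L → 0 ≤ κ → 0 ≤ σ → σ ≤ 2 → (∀ p, p.Prime → p ≠ 2 → (∀ (n : ℕ) (q : Fin n → ℕ) (e : Fin n → ℤ), (∀ i, (q i).Prime) → Function.Injective q → (∀ i, q i ≠ p) → e ≠ 0 → ∏ i, ((q i : ℚ)) ^ e i ≠ 1 → (padicValRat p (∏ i, ((q i : ℚ)) ^ e i - 1) : ℝ) ≤ K * L ^ n * (n : ℝ) ^ (κ * n) * (p : ℝ) ^ σ * (∏ i, Real.log (q i)) * Real.log (max 3 ((Finset.univ.sup fun i => (e i).natAbs : ℕ) : ℝ)) ^ τ * Real.log (max 3 (∏ i, ((q i : ℕ) : ℝ))) ^ τ₁)) → Literature.Barriers.ABC.EpsShapeBound (max 1 κ)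

-- `OddKappaDoorSpec` holds: proved by `Summit.ABC.ABC.Theorems.padicPrimesW80OddRadOne_oddKappaDoorSpec_proof` (its module imports this route file, so no `_holds` link can be stated here).

/-- item stmt-ABC-19537 · assembly · rank 1 · closed · proved by Summit.ABC.ABC.Theorems.padicPrimesW80OddRadOne_assembly_proof (prover) · by planner
sources: StewartYu1991
[assembly] W80ThreeModFour → W80OneModFour → FinFromW80Odd → OddKappaDoorSpec → the rung leaf
EpsShapeBoundOne (`closes_target`). [deps: W80ThreeModFour, W80OneModFour, FinFromW80Odd,
OddKappaDoorSpec] [difficulty: provable-now] -/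
@[route_item "route-ABC-PadicPrimesW80OddRadOne"]
def Assembly : Prop :=
  W80ThreeModFour → W80OneModFour → FinFromW80Odd → OddKappaDoorSpec → Literature.Barriers.ABC.EpsShapeBoundOne

-- `Assembly` holds: proved by `Summit.ABC.ABC.Theorems.padicPrimesW80OddRadOne_assembly_proof` (its module imports this route file, so no `_holds` link can be stated here).

/-! D-0027 §2.1 — DECIDING THEOREM (planner-authored via `route open/edit --closes-file`; by planner-abc-stewartyu-plan-g4-0 2026-08-26T07:19:36Z) — ARCHIVED: route closed (proved) 2026-08-26T11:53:31Z; kept so importers keep building: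
its hypotheses are this route's items and its conclusion the registered leaf `Literature.Barriers.ABC.EpsShapeBoundOne` (rung F-A1.M2⁻, D-0061) (glue_lint), and it elaborates with this file. -/

@[closes "route-ABC-PadicPrimesW80OddRadOne"] theorem closes (h₃ : W80ThreeModFour) (h₁ : W80OneModFour) (hF : FinFromW80Odd) (hO : OddKappaDoorSpec) :
    Literature.Barriers.ABC.EpsShapeBoundOne := by
  obtain ⟨K, L, hK, hL, h⟩ := hF h₃ h₁
  have h' : Literature.Barriers.ABC.EpsShapeBound (max 1 1) :=
    hO K L 1 2 1 2 hK hL zero_le_one (by norm_num) le_rfl h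
  exact Literature.Barriers.ABC.epsShapeBoundOne_iff.mpr (by simpa using h')

end Summit.ABC.ABC.Theses.PadicPrimesW80OddRadOne
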